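import Literature.NumberTheory.EllipticCurves.PlusMinusPAdicLFunctionProofs
import Literature.NumberTheory.EllipticCurves.Sprung2012.ColemanMaps
import HarnessLib

/-!
# Kobayashi's Prop. 8.19 in Sprung's functional vocabulary, at EVERY prime `p` (in particular `p = 2`):
# the orbit sums `P_{n, c_n}(z)` of a trace-compatible family `Tr_{n+2/n+1} c_{n+2} = −c_n` are divisible by
# `ω⁻_n` (`n` even) / `ω⁺_n` (`n` odd) — the image of the `±` Coleman functional lies in `ω̃^∓_n Λ_n`

Route `ResidualThetaTransportAtTwo` (RTT), crux RSL_g `ResidualSignedLambdaLowerCMAtTwo` (stmt-BirchSwinnertonDyer-22608;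
node N1 «local⁺ at 2» of `Cruxes/ResidualThetaCountLowerPureAtTwo/RSLG-LINE-DAG-g14.md`, cf. `CSCAN-SIGNED-AT-TWO-g14.md` §3bis (i)).
Seat `prover-bsd-wall-rtt-p2` g14 (lead lineage of (R≥)ᵖ 26074; `--supports`, closes nothing). HONEST FRAMING: THEOREMS ONLY
(no definition, no named fact, no instance, no `sorry`); pure polynomial algebra over a commutative ring plus a bridge to
`Sprung2012.pairingSum`; nothing about any Selmer group or `L`-function; valid for every prime `p`; BSD is not proved by any of this.

## What and why

Kobayashi (Invent. Math. 152 (2003), Prop. 8.19, p. 20): «The image of `P_n^±` is contained in `ω̃_n^∓(X) Λ_n`», proved there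
with characters of `G_n`. Here it is proved by POLYNOMIAL ALGEBRA, exactly as the tree proves the analytic twin
`cyclotomicOmegaMinus_dvd_mazurTateElement` (Pollack 2003 Prop. 6.18) from the three-term relation of the Mazur–Tate elements:

* §1 (abstract, any commutative ring `R`, any prime `p`). For coefficient sequences `a = (z(gʲc_{n+2}))_j`, `b = (z(gʲc_n))_j` with
  `b` `pⁿ`-periodic and the TRACE RELATION `∑_{s<p} a(r + p^{n+1}s) = −b(r)`, the orbit polynomials
  `Q_N(a) = ∑_{j<p^N} C(a_j)(X+1)ʲ` satisfy the Mazur–Tate-shaped three-term congruence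
  **`ω_{n+1} ∣ Q_{n+2}(a) + Φ_{p^{n+1}}(X+1)·Q_n(b)`** (`cyclotomicOmega_dvd_orbitSum_add`); hence for a whole family
  `(a_n)_n` with these two properties **`ω⁻_{2m} ∣ Q_{2m}(a_{2m})`** and **`ω⁺_{2m+1} ∣ Q_{2m+1}(a_{2m+1})`**
  (`cyclotomicOmegaMinus_dvd_orbitSum`, `cyclotomicOmegaPlus_dvd_orbitSum`; `ω^±` = `cyclotomicOmegaPlus/Minus`, Pollack's labelling,
  WITHOUT the factor `X` — Kobayashi's `ω̃^±`).
* §2 (bridge). For Sprung's `pairingSum W A g n x z = ∑_{j<pⁿ} C(z(gʲ•x))(1+T)ʲ ∈ Λ = ℤ_p⟦T⟧` (`Sprung2012/ColemanMaps.lean`, Def. 3.1) and a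
  family of local points `c : ℕ → E(K̄_v)` with `g^{pⁿ} • c n = c n` (level `n`) and `∑_{s<p} g^{s p^{n+1}} • c (n+2) = −c n`
  (the trace relation `Tr_{n+2/n+1} c_{n+2} = −c_n` written with the powers of a local generator `g`; `a_p = 0` shape, Kobayashi
  Lemma 8.9 / Sprung Thm. 2.2 (1); at `p = 2` on the `ℤ₂`-tower: HONDA⁺@2 clause (TR)), whose orbits lie in `A`:
  **`ω⁻_{2m} ∣ P_{2m, c_{2m}}(z)`** and **`ω⁺_{2m+1} ∣ P_{2m+1, c_{2m+1}}(z)`** in `Λ` for EVERY functional `z : A →+ ℤ_p`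
  (`cyclotomicOmegaMinus_dvd_pairingSum`, `cyclotomicOmegaPlus_dvd_pairingSum`). No hypothesis on `p` (no `p ≠ 2`), on torsion,
  or on the bottom relation `Tr_{1/0}` (not used: `ω⁻_0 = ω⁺_1 = 1`).
This is the divisibility that makes the `±` Coleman maps `Col^±_n := P^±_n / ω̃^∓_n` well defined (Kobayashi Cor. 8.20) at every
prime; at `p = 2` it is step (i) of the surjectivity proof of `Col⁺` on the cyclotomic `ℤ₂`-tower (CSCAN-SIGNED-AT-TWO-g14 §3bis).

References: [Kobayashi2003] S. Kobayashi, Invent. Math. 152 (2003) 1–36, Lemma 8.9, Lemma 8.15, Prop. 8.19, Cor. 8.20 (pp. 16–21);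
[Sprung2012] F. Sprung, J. Number Theory 132 (2012), Def. 3.1 (p. 1489), Thm. 2.2 (p. 1487); [Pollack2003] R. Pollack, Duke Math. J.
118 (2003), Prop. 6.18 (the analytic twin); [Washington1997] §7.2 (`ω_n`, `Φ_{pⁿ}(1+T)`).
-/

set_option autoImplicit false
-- the Theorems namespace of this sub repeats the summit name by design (D-0017 nested layout)
set_option linter.dupNamespace false

noncomputable section

open scoped Classical
open Polynomial Finset

namespace Summit.BirchSwinnertonDyer.BirchSwinnertonDyer.Theorems.SignedColemanImage

open Literature.NumberTheory.EllipticCurves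

/-! ## §0 Reindexing -/

section Reindex

variable {M : Type*} [AddCommMonoid M]

/-- `∑_{k < a·b} g(k) = ∑_{j < a} ∑_{t < b} g(t + b·j)` (Euclidean division by `b`). [folklore] -/
theorem sum_range_mul_eq_sum_sum (a b : ℕ) (g : ℕ → M) :
    ∑ k ∈ range (a * b), g k = ∑ j ∈ range a, ∑ t ∈ range b, g (t + b * j) := by
  rw [← Fin.sum_univ_eq_sum_range g (a * b),
    ← finProdFinEquiv.sum_comp (fun x : Fin (a * b) ↦ g x), Fintype.sum_prod_type,
    ← Fin.sum_univ_eq_sum_range (fun j ↦ ∑ t ∈ range b, g (t + b * j)) a]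
  refine sum_congr rfl fun j _ ↦ ?_
  rw [← Fin.sum_univ_eq_sum_range (fun t ↦ g (t + b * j)) b]
  refine sum_congr rfl fun t _ ↦ ?_
  rw [finProdFinEquiv_apply_val]

/-- A `q`-periodic sequence is `q·s`-periodic. [folklore] -/
theorem periodic_add_mul {β : Type*} {b : ℕ → β} {q : ℕ} (hb : ∀ t, b (t + q) = b t) (s t : ℕ) :
    b (t + q * s) = b t := by
  induction s with
  | zero => simp
  | succ s ih => rw [Nat.mul_succ, ← add_assoc, hb, ih]

end Reindex

/-! ## §1 The abstract three-term congruence and the `ω^∓`-divisibility of orbit polynomials -/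

section Abstract

variable {R : Type*} [CommRing R] {p : ℕ}

/-- `ω_n ↦ (X+1)^{pⁿ} − 1` under any `ℤ → R`. [cite: Pollack2003, Thm. 6.17] -/
theorem map_cyclotomicOmega (n : ℕ) :
    (cyclotomicOmega p n).map (Int.castRingHom R) = (X + 1) ^ p ^ n - 1 := by
  simp [cyclotomicOmega]

/-- `Φ_{p^{n+1}}(X+1) = ∑_{s<p} ((X+1)^{pⁿ})^s` over any `R` (`p` prime). [cite: Washington1997, §7.2] -/
theorem map_cyclotomic_comp_eq_sum (hp : p.Prime) (n : ℕ) :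
    ((cyclotomic (p ^ (n + 1)) ℤ).comp (X + 1)).map (Int.castRingHom R) =
      ∑ s ∈ range p, ((X + 1 : R[X]) ^ p ^ n) ^ s := by
  rw [cyclotomic_prime_pow_eq_geom_sum hp, Polynomial.sum_comp, Polynomial.map_sum]
  refine sum_congr rfl fun s _ ↦ ?_
  simp [pow_comp, Polynomial.map_pow]

/-- **The three-term congruence** (Kobayashi Lemma 8.15 + Lemma 8.9 in polynomial form; the algebraic twin of the tree's
`cyclotomicOmega_dvd_mazurTateElement_add`): if `b` is `pⁿ`-periodic and `∑_{s<p} a(r + p^{n+1}s) = −b(r)` for every `r`, then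
`ω_{n+1} ∣ ∑_{j<p^{n+2}} C(a_j)(X+1)ʲ + Φ_{p^{n+1}}(X+1) · ∑_{j<pⁿ} C(b_j)(X+1)ʲ` in `R[X]`.
[cite: Kobayashi2003, Lemma 8.15 and Prop. 8.19 (pp. 19–20)] -/
theorem cyclotomicOmega_dvd_orbitSum_add (hp : p.Prime) (n : ℕ) (a b : ℕ → R)
    (hb : ∀ t, b (t + p ^ n) = b t) (htr : ∀ r, ∑ s ∈ range p, a (r + p ^ (n + 1) * s) = -b r) :
    (cyclotomicOmega p (n + 1)).map (Int.castRingHom R) ∣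
      (∑ j ∈ range (p ^ (n + 2)), C (a j) * (X + 1) ^ j) +
        ((cyclotomic (p ^ (n + 1)) ℤ).comp (X + 1)).map (Int.castRingHom R) *
          ∑ j ∈ range (p ^ n), C (b j) * (X + 1) ^ j := by
  -- (1) reindex the big sum along `j = r + p^{n+1}·s`
  have h1 : ∑ j ∈ range (p ^ (n + 2)), C (a j) * (X + 1 : R[X]) ^ j =
      ∑ s ∈ range p, ∑ r ∈ range (p ^ (n + 1)), C (a (r + p ^ (n + 1) * s)) * (X + 1) ^ (r + p ^ (n + 1) * s) := by
    rw [show p ^ (n + 2) = p * p ^ (n + 1) by ring]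
    exact sum_range_mul_eq_sum_sum p (p ^ (n + 1)) (fun k ↦ C (a k) * (X + 1 : R[X]) ^ k)
  -- (2) the level-`n` sum read at level `n+1` is `Φ · Q_n`
  have h2 : ∑ r ∈ range (p ^ (n + 1)), C (b r) * (X + 1 : R[X]) ^ r =
      ((cyclotomic (p ^ (n + 1)) ℤ).comp (X + 1)).map (Int.castRingHom R) *
        ∑ j ∈ range (p ^ n), C (b j) * (X + 1) ^ j := by
    rw [map_cyclotomic_comp_eq_sum hp, show p ^ (n + 1) = p * p ^ n by ring,
      sum_range_mul_eq_sum_sum p (p ^ n) (fun k ↦ C (b k) * (X + 1 : R[X]) ^ k), sum_mul]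
    refine sum_congr rfl fun s _ ↦ ?_
    rw [mul_sum]
    refine sum_congr rfl fun t _ ↦ ?_
    rw [periodic_add_mul hb s t, pow_add (X + 1 : R[X]) t (p ^ n * s), pow_mul (X + 1 : R[X]) (p ^ n) s]
    ring
  -- (3) the trace relation: the same sum is `−∑_s ∑_r C(a(r + p^{n+1} s))(X+1)^r`
  have h3 : ∑ r ∈ range (p ^ (n + 1)), C (b r) * (X + 1 : R[X]) ^ r =
      -∑ s ∈ range p, ∑ r ∈ range (p ^ (n + 1)), C (a (r + p ^ (n + 1) * s)) * (X + 1) ^ r := by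
    rw [sum_comm, ← sum_neg_distrib]
    refine sum_congr rfl fun r _ ↦ ?_
    rw [← sum_mul, ← map_sum C, htr r, map_neg, neg_mul, neg_neg]
  rw [← h2, h3, h1, ← sub_eq_add_neg, ← sum_sub_distrib]
  refine dvd_sum fun s _ ↦ ?_
  rw [← sum_sub_distrib]
  refine dvd_sum fun r _ ↦ ?_
  rw [← mul_sub, pow_add (X + 1 : R[X]) r (p ^ (n + 1) * s), ← mul_sub_one, pow_mul (X + 1 : R[X]) (p ^ (n + 1)) s]
  refine Dvd.dvd.mul_left (Dvd.dvd.mul_left ?_ _) _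
  rw [map_cyclotomicOmega]
  exact sub_one_dvd_pow_sub_one _ s

/-- **`ω⁻_{2m} ∣ Q_{2m}`** for a family `a : ℕ → ℕ → R` with `a n` `pⁿ`-periodic and
`∑_{s<p} a (n+2) (r + p^{n+1}s) = −a n r` (all `n, r`): induction on `m` from the three-term congruence, exactly as
`cyclotomicOmegaMinus_dvd_mazurTateElement` (`ω⁻_{2m+2} = ω⁻_{2m}·Φ_{p^{2m+1}}(X+1)` divides `ω_{2m+1}` and `Φ·Q_{2m}`).
[cite: Kobayashi2003, Prop. 8.19 (p. 20)] [cite: Pollack2003, Prop. 6.18 (proof, the analytic twin)] -/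
theorem cyclotomicOmegaMinus_dvd_orbitSum [Fact p.Prime] (a : ℕ → ℕ → R)
    (hper : ∀ n t, a n (t + p ^ n) = a n t)
    (htr : ∀ n r, ∑ s ∈ range p, a (n + 2) (r + p ^ (n + 1) * s) = -a n r) (m : ℕ) :
    (cyclotomicOmegaMinus p (2 * m)).map (Int.castRingHom R) ∣
      ∑ j ∈ range (p ^ (2 * m)), C (a (2 * m) j) * (X + 1) ^ j := by
  have hp : p.Prime := Fact.out
  induction m with
  | zero => simp
  | succ m ih =>
    obtain ⟨Cq, hC⟩ := cyclotomicOmega_dvd_orbitSum_add hp (2 * m) (a (2 * m + 2)) (a (2 * m)) (hper (2 * m))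
      (htr (2 * m))
    have h : ∑ j ∈ range (p ^ (2 * (m + 1))), C (a (2 * (m + 1)) j) * (X + 1 : R[X]) ^ j =
        (cyclotomicOmega p (2 * m + 1)).map (Int.castRingHom R) * Cq -
          ((cyclotomic (p ^ (2 * m + 1)) ℤ).comp (X + 1)).map (Int.castRingHom R) *
            ∑ j ∈ range (p ^ (2 * m)), C (a (2 * m) j) * (X + 1) ^ j := by
      rw [show 2 * (m + 1) = 2 * m + 2 by ring, ← hC, add_sub_cancel_right]
    rw [h, show 2 * (m + 1) = 2 * m + 2 by ring, cyclotomicOmegaMinus_two_mul_add_two, Polynomial.map_mul]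
    refine dvd_sub (Dvd.dvd.mul_right ?_ _) ?_
    · rw [← Polynomial.map_mul, ← cyclotomicOmegaMinus_two_mul_add_two, ← cyclotomicOmegaMinus_two_mul_add_one,
        ← X_mul_cyclotomicOmegaPlus_mul_cyclotomicOmegaMinus]
      exact Polynomial.map_dvd _ (dvd_mul_left _ _)
    · rw [mul_comm (((cyclotomic (p ^ (2 * m + 1)) ℤ).comp (X + 1)).map (Int.castRingHom R))]
      exact mul_dvd_mul ih dvd_rfl

/-- **`ω⁺_{2m+1} ∣ Q_{2m+1}`** for the same kind of family (odd levels; `ω⁺_1 = 1`).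
[cite: Kobayashi2003, Prop. 8.19 (p. 20)] [cite: Pollack2003, Prop. 6.18 (proof, the analytic twin)] -/
theorem cyclotomicOmegaPlus_dvd_orbitSum [Fact p.Prime] (a : ℕ → ℕ → R)
    (hper : ∀ n t, a n (t + p ^ n) = a n t)
    (htr : ∀ n r, ∑ s ∈ range p, a (n + 2) (r + p ^ (n + 1) * s) = -a n r) (m : ℕ) :
    (cyclotomicOmegaPlus p (2 * m + 1)).map (Int.castRingHom R) ∣
      ∑ j ∈ range (p ^ (2 * m + 1)), C (a (2 * m + 1) j) * (X + 1) ^ j := by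
  have hp : p.Prime := Fact.out
  induction m with
  | zero =>
    rw [show 2 * 0 + 1 = 2 * 0 + 1 from rfl, cyclotomicOmegaPlus_two_mul_add_one, mul_zero, cyclotomicOmegaPlus_zero,
      Polynomial.map_one]
    exact one_dvd _
  | succ m ih =>
    obtain ⟨Cq, hC⟩ := cyclotomicOmega_dvd_orbitSum_add hp (2 * m + 1) (a (2 * m + 3)) (a (2 * m + 1))
      (hper (2 * m + 1)) (htr (2 * m + 1))
    have h : ∑ j ∈ range (p ^ (2 * (m + 1) + 1)), C (a (2 * (m + 1) + 1) j) * (X + 1 : R[X]) ^ j =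
        (cyclotomicOmega p (2 * m + 1 + 1)).map (Int.castRingHom R) * Cq -
          ((cyclotomic (p ^ (2 * m + 1 + 1)) ℤ).comp (X + 1)).map (Int.castRingHom R) *
            ∑ j ∈ range (p ^ (2 * m + 1)), C (a (2 * m + 1) j) * (X + 1) ^ j := by
      rw [show 2 * (m + 1) + 1 = 2 * m + 1 + 2 by ring, ← hC, show 2 * m + 1 + 2 = 2 * m + 3 by ring,
        add_sub_cancel_right]
    rw [h, show 2 * (m + 1) + 1 = 2 * (m + 1) + 1 from rfl,
      show cyclotomicOmegaPlus p (2 * (m + 1) + 1) = cyclotomicOmegaPlus p (2 * m + 1) *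
          (cyclotomic (p ^ (2 * m + 2)) ℤ).comp (X + 1) by
        rw [cyclotomicOmegaPlus_two_mul_add_one, show 2 * (m + 1) = 2 * m + 2 by ring,
          cyclotomicOmegaPlus_two_mul_add_two, cyclotomicOmegaPlus_two_mul_add_one],
      Polynomial.map_mul, show 2 * m + 1 + 1 = 2 * m + 2 by ring]
    refine dvd_sub (Dvd.dvd.mul_right ?_ _) ?_
    · rw [← Polynomial.map_mul]
      refine Polynomial.map_dvd _ ?_
      rw [← X_mul_cyclotomicOmegaPlus_mul_cyclotomicOmegaMinus, cyclotomicOmegaPlus_two_mul_add_two,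
        cyclotomicOmegaPlus_two_mul_add_one]
      exact Dvd.dvd.mul_right (dvd_mul_left _ _) _
    · rw [mul_comm (((cyclotomic (p ^ (2 * m + 2)) ℤ).comp (X + 1)).map (Int.castRingHom R))]
      exact mul_dvd_mul ih dvd_rfl

end Abstract

/-! ## §2 Bridge to Sprung's `pairingSum`: `ω^∓_n ∣ P_{n, c_n}(z)` for a trace-compatible family of local points -/

section Sprung

universe u

variable {K : Type u} [Field K] {p : ℕ} [Fact p.Prime]
variable {E : Type u} [Field E] [Algebra K E] (W : WeierstrassCurve K)

/-- `pairingSum` is the power series of the orbit polynomial `∑_{j<pⁿ} C(z(gʲ•x))(X+1)ʲ`.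
[cite: Sprung2012, Def. 3.1 (p. 1489) (unfolding)] -/
theorem pairingSum_eq_coe_orbitSum (A : AddSubgroup (localPoints W E)) (g : Field.absoluteGaloisGroup E) (n : ℕ)
    (x : localPoints W E) (z : A →+ ℤ_[p]) :
    Sprung2012.pairingSum W A g n x z =
      ((∑ j ∈ range (p ^ n), C (Sprung2012.evalOn W A z (g ^ j • x)) * (X + 1) ^ j : ℤ_[p][X]) :
        PowerSeries ℤ_[p]) := by
  rw [Sprung2012.pairingSum_def, ← Polynomial.coeToPowerSeries.ringHom_apply, map_sum]
  refine sum_congr rfl fun j _ ↦ ?_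
  rw [map_mul, map_pow, map_add, Polynomial.coeToPowerSeries.ringHom_apply, Polynomial.coeToPowerSeries.ringHom_apply,
    Polynomial.coeToPowerSeries.ringHom_apply, Polynomial.coe_C, Polynomial.coe_X, Polynomial.coe_one, add_comm]

/-- The coefficient family `a n j := z(gʲ • c n)` of a trace-compatible family of points is periodic and satisfies the trace
relation of §1: `g^{pⁿ}` fixes `c n`, and `∑_{s<p} g^{p^{n+1}s} • c (n+2) = −c n`, with all orbits inside `A`.
[cite: Kobayashi2003, Lemma 8.9 and Lemma 8.15 (pp. 16, 19)] [cite: Sprung2012, Thm. 2.2 (1) (p. 1487)] -/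
theorem orbitCoeff_periodic_and_trace (A : AddSubgroup (localPoints W E)) (g : Field.absoluteGaloisGroup E)
    (c : ℕ → localPoints W E) (hA : ∀ n j, g ^ j • c n ∈ A) (hfix : ∀ n, g ^ p ^ n • c n = c n)
    (htr : ∀ n, ∑ s ∈ range p, g ^ (p ^ (n + 1) * s) • c (n + 2) = -c n) (z : A →+ ℤ_[p]) :
    (∀ n t, Sprung2012.evalOn W A z (g ^ (t + p ^ n) • c n) = Sprung2012.evalOn W A z (g ^ t • c n)) ∧
      ∀ n r, ∑ s ∈ range p, Sprung2012.evalOn W A z (g ^ (r + p ^ (n + 1) * s) • c (n + 2)) =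
        -Sprung2012.evalOn W A z (g ^ r • c n) := by
  refine ⟨fun n t ↦ by rw [pow_add, mul_smul, hfix], fun n r ↦ ?_⟩
  have hmem : ∀ s, g ^ (r + p ^ (n + 1) * s) • c (n + 2) ∈ A := fun s ↦ hA _ _
  have hsum_pt : ∑ s ∈ range p, g ^ (r + p ^ (n + 1) * s) • c (n + 2) = -(g ^ r • c n) := by
    rw [← smul_neg, ← htr n, smul_sum]
    exact sum_congr rfl fun s _ ↦ by rw [← mul_smul, ← pow_add]
  calc ∑ s ∈ range p, Sprung2012.evalOn W A z (g ^ (r + p ^ (n + 1) * s) • c (n + 2))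
      = ∑ s ∈ range p, z ⟨g ^ (r + p ^ (n + 1) * s) • c (n + 2), hmem s⟩ :=
        sum_congr rfl fun s _ ↦ Sprung2012.evalOn_of_mem W A z (hmem s)
    _ = z (∑ s ∈ range p, ⟨g ^ (r + p ^ (n + 1) * s) • c (n + 2), hmem s⟩) := (map_sum z _ _).symm
    _ = z (-⟨g ^ r • c n, hA n r⟩) := by
        congr 1
        apply Subtype.ext
        push_cast
        exact hsum_pt
    _ = -Sprung2012.evalOn W A z (g ^ r • c n) := by
        rw [map_neg, Sprung2012.evalOn_of_mem W A z (hA n r)]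

/-- **`ω⁻_{2m} ∣ P_{2m, c_{2m}}(z)` in `Λ = ℤ_p⟦T⟧`** for every functional `z : A →+ ℤ_p`, every local Galois element `g`
and every family of local points `c` with `g^{pⁿ} • c n = c n`, `∑_{s<p} g^{p^{n+1}s} • c (n+2) = −c n` and orbits in `A`
(Kobayashi Prop. 8.19 for `P⁺`: the even-indexed orbit sums vanish at all odd-level characters), ANY prime `p`.
[cite: Kobayashi2003, Prop. 8.19 (p. 20)] [cite: Sprung2012, Def. 3.1 (p. 1489)] -/
theorem cyclotomicOmegaMinus_dvd_pairingSum (A : AddSubgroup (localPoints W E)) (g : Field.absoluteGaloisGroup E)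
    (c : ℕ → localPoints W E) (hA : ∀ n j, g ^ j • c n ∈ A) (hfix : ∀ n, g ^ p ^ n • c n = c n)
    (htr : ∀ n, ∑ s ∈ range p, g ^ (p ^ (n + 1) * s) • c (n + 2) = -c n) (z : A →+ ℤ_[p]) (m : ℕ) :
    (((cyclotomicOmegaMinus p (2 * m)).map (Int.castRingHom ℤ_[p]) : ℤ_[p][X]) : PowerSeries ℤ_[p]) ∣
      Sprung2012.pairingSum W A g (2 * m) (c (2 * m)) z := by
  obtain ⟨hper, htr'⟩ := orbitCoeff_periodic_and_trace W A g c hA hfix htr z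
  rw [pairingSum_eq_coe_orbitSum, ← Polynomial.coeToPowerSeries.ringHom_apply, ← Polynomial.coeToPowerSeries.ringHom_apply]
  exact map_dvd _ (cyclotomicOmegaMinus_dvd_orbitSum (fun n j ↦ Sprung2012.evalOn W A z (g ^ j • c n)) hper htr' m)

/-- **`ω⁺_{2m+1} ∣ P_{2m+1, c_{2m+1}}(z)` in `Λ`** (Kobayashi Prop. 8.19 for `P⁻`: the odd-indexed orbit sums vanish at all
even-level characters), same hypotheses, ANY prime `p`. [cite: Kobayashi2003, Prop. 8.19 (p. 20)] [cite: Sprung2012, Def. 3.1 (p. 1489)] -/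
theorem cyclotomicOmegaPlus_dvd_pairingSum (A : AddSubgroup (localPoints W E)) (g : Field.absoluteGaloisGroup E)
    (c : ℕ → localPoints W E) (hA : ∀ n j, g ^ j • c n ∈ A) (hfix : ∀ n, g ^ p ^ n • c n = c n)
    (htr : ∀ n, ∑ s ∈ range p, g ^ (p ^ (n + 1) * s) • c (n + 2) = -c n) (z : A →+ ℤ_[p]) (m : ℕ) :
    (((cyclotomicOmegaPlus p (2 * m + 1)).map (Int.castRingHom ℤ_[p]) : ℤ_[p][X]) : PowerSeries ℤ_[p]) ∣
      Sprung2012.pairingSum W A g (2 * m + 1) (c (2 * m + 1)) z := by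
  obtain ⟨hper, htr'⟩ := orbitCoeff_periodic_and_trace W A g c hA hfix htr z
  rw [pairingSum_eq_coe_orbitSum, ← Polynomial.coeToPowerSeries.ringHom_apply, ← Polynomial.coeToPowerSeries.ringHom_apply]
  exact map_dvd _ (cyclotomicOmegaPlus_dvd_orbitSum (fun n j ↦ Sprung2012.evalOn W A z (g ^ j • c n)) hper htr' m)

end Sprung

end Summit.BirchSwinnertonDyer.BirchSwinnertonDyer.Theorems.SignedColemanImage

end
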